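import Summits.HubbardSuperconductivity.HubbardSuperconductivity.Theorems.BalabanIRBirGappedPhaseReductionSectorGibbs

/-!
# Route BalabanIR — crux 4 `BirGappedPhaseReduction` (item `stmt-HubbardSuperconductivity-2082`): logical status and the thermal form of the reduction

`BirGappedPhaseReduction := BirComplexStableXY → BirGroundStateAverageLRO` (engine → target).

* Logic (`birGappedPhaseReduction_of_not_engine`, `not_birGappedPhaseReduction_iff`): the item is
  glue — it follows vacuously from the negation of the engine (the closing term if item 2080 is
  refuted as typed), and `¬ item ↔ engine ∧ ¬ target` (it is refutable only by proving the engine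
  AND refuting the target).
* The zero-temperature step of the reduction's dictionary on the Hubbard torus
  (`birTraceBound_of_eventually_thermal`, from `tendsto_sectorGibbs_atTop` of
  `BalabanIRBirGappedPhaseReductionSectorGibbs.lean`; the `(2m, S^z = 0)` sector is invariant,
  `hubbardTorus_mulVec_mem_szSector`, and its ground eigenspace is non-trivial,
  `hubbardTorus_groundEigenspace_ne_bot`): an eventual-in-`β` lower bound `c L⁴` on the canonical
  sector Gibbs average of `Δ_d† Δ_d` gives the target's inequality
  `c · L⁴ · re tr P ≤ re tr (P Δ_d† Δ_d)` at that `(U, L)`.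
* Hence the THERMAL form of the target implies the target (`birGroundStateAverageLRO_of_thermal`)
  and the reduction may be delivered in thermal form (`birGappedPhaseReduction_of_thermal`): what
  the engine has to produce on the Hubbard side is a `β`-uniform bound on canonical equilibrium
  averages, the natural output of a functional integral on the `(2+1)`-dimensional torus with
  `M = β/a → ∞` time slices.

Sources: H. Tasaki, *Physics and Mathematics of Quantum Many-Body Systems* (2020), App. A, §2.2;
E. H. Lieb, PRL 62 (1989) 1201 (sectors of the Hubbard Hamiltonian). Folklore; no definition is
introduced.
-/

noncomputable section

open scoped Matrix.Norms.L2Operator ComplexOrder MatrixOrder InnerProductSpace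

namespace Summit.HubbardSuperconductivity.HubbardSuperconductivity.Theorems

open Matrix Filter Topology Literature.MathematicalPhysics.QuantumLattice
open Summit.HubbardSuperconductivity.HubbardSuperconductivity.Theses.BalabanIR

/-! ### Logical status of the item -/

/-- The reduction `BirGappedPhaseReduction := engine → target` follows (vacuously) from the
negation of the engine `BirComplexStableXY`; this is the closing term of item 2082 if item 2080 is
refuted as typed. [folklore] -/
theorem birGappedPhaseReduction_of_not_engine (h : ¬ BirComplexStableXY) :
    BirGappedPhaseReduction :=
  fun hE => absurd hE h

/-- `¬ BirGappedPhaseReduction ↔ BirComplexStableXY ∧ ¬ BirGroundStateAverageLRO`: the item is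
refutable only by proving the engine AND refuting the target. [folklore] -/
theorem not_birGappedPhaseReduction_iff :
    ¬ BirGappedPhaseReduction ↔ (BirComplexStableXY ∧ ¬ BirGroundStateAverageLRO) := by
  unfold BirGappedPhaseReduction
  exact Classical.not_imp

/-! ### The Hubbard torus: the thermal form of the target and of the reduction -/

section Hubbard

open Literature.Probability.LatticeModels

/-- The joint sector `(N, S^z) = (2m, 0)` is invariant under the Hubbard Hamiltonian of the torus
(`H` conserves `(N↑, N↓)`, `LiebThm1.preservesSectors_hamiltonian`). Lieb, PRL 62 (1989) 1201.
[folklore] -/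
theorem hubbardTorus_mulVec_mem_szSector (d L : ℕ) (t U : ℝ) (m : ℕ)
    {ψ : Fock (Orb (FermionTorus d L))} (hψ : ψ ∈ szSector (Λ := FermionTorus d L) (2 * m) 0) :
    hubbardTorus d L t U *ᵥ ψ ∈ szSector (Λ := FermionTorus d L) (2 * m) 0 := by
  rw [mem_szSector_two_mul_zero_iff] at hψ ⊢
  exact (LiebThm1.preservesSectors_hamiltonian (fermionTorusGraph d L) t U).isInSector_mulVec hψ

/-- **The zero-temperature step of the reduction, on the Hubbard torus.** For any side `L ≥ 1`,
hopping `t`, coupling `U`, `δ ≥ -1` and constant `c`: if the canonical `(2⌊(1-δ)L²/2⌋, S^z = 0)`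
sector Gibbs average of `Δ_d† Δ_d` is `≥ c L⁴` for all large `β`, then the target's inequality
`c · L⁴ · re tr P ≤ re tr (P Δ_d† Δ_d)` holds for the projection `P` onto the sector ground
eigenspace (`mul_re_trace_le_of_eventually_sectorGibbs`; the sector is `H`-invariant and its
ground eigenspace is non-trivial, `hubbardTorus_groundEigenspace_ne_bot`). Tasaki (2020) App. A.
[folklore] -/
theorem birTraceBound_of_eventually_thermal (L : ℕ) [NeZero L] (t U δ c : ℝ) (hδ : -1 ≤ δ) :
    let N : ℕ := 2 * ⌊(1 - δ) * (L : ℝ) ^ 2 / 2⌋₊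
    let H := hubbardTorus 2 L t U
    let S := szSector (Λ := FermionTorus 2 L) N 0
    let E₀ := S ⊓ Module.End.eigenspace (Matrix.toLin' H) ((H.minEnergyOn S : ℝ) : ℂ)
    let P := projMatrix (E₀.map (Fock.toEuclidean (ι := Orb (FermionTorus 2 L)) :
      Fock (Orb (FermionTorus 2 L)) →ₗ[ℂ] EuclideanSpace ℂ (Finset (Orb (FermionTorus 2 L)))))
    let PS := projMatrix (S.map (Fock.toEuclidean (ι := Orb (FermionTorus 2 L)) :
      Fock (Orb (FermionTorus 2 L)) →ₗ[ℂ] EuclideanSpace ℂ (Finset (Orb (FermionTorus 2 L)))))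
    let A := (pairField dWaveFormFactor L)ᴴ * pairField dWaveFormFactor L
    (∀ᶠ β : ℝ in atTop, c * (L : ℝ) ^ 4 ≤
        ((PS * gibbsWeight β H * A).trace / (PS * gibbsWeight β H).trace).re) →
      c * (L : ℝ) ^ 4 * P.trace.re ≤ (P * A).trace.re := by
  intro N H S E₀ P PS A hth
  have hm : ⌊(1 - δ) * (L : ℝ) ^ 2 / 2⌋₊ ≤ Fintype.card (FermionTorus 2 L) := by
    have hcard : Fintype.card (FermionTorus 2 L) = L ^ 2 := by simp
    rw [hcard]
    apply Nat.floor_le_of_le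
    have hL : (0 : ℝ) ≤ (L : ℝ) ^ 2 := by positivity
    push_cast
    nlinarith
  have hH : H.IsHermitian := LiebThm1.hamiltonian_isHermitian (fermionTorusGraph 2 L) t U
  have hinv : ∀ v ∈ S, H *ᵥ v ∈ S := fun v hv => hubbardTorus_mulVec_mem_szSector 2 L t U _ hv
  have hE₀ : E₀ ≠ ⊥ := hubbardTorus_groundEigenspace_ne_bot 2 L t U hm
  exact mul_re_trace_le_of_eventually_sectorGibbs hH S hinv hE₀ A (c * (L : ℝ) ^ 4) hth

/-- **Thermal form of the target.** If, for some `δ ∈ (0,1/2)`, an open window `(U₁,U₂) ⊂ (0,∞)`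
and `c > 0`, for every `U` in the window, eventually in even `L`, the canonical
`(2⌊(1-δ)L²/2⌋, S^z = 0)`-sector Gibbs average of `Δ_d† Δ_d` for `hubbardTorus 2 L 1 U` is
`≥ c L⁴` for all large `β` (the natural output of a functional-integral representation, uniform in
`β`), then `BirGroundStateAverageLRO` holds (`birTraceBound_of_eventually_thermal`).
Tasaki (2020) App. A. [folklore] -/
theorem birGroundStateAverageLRO_of_thermal
    (h : ∃ δ ∈ Set.Ioo (0:ℝ) (1/2), ∃ U₁ U₂ c : ℝ, 0 < U₁ ∧ U₁ < U₂ ∧ 0 < c ∧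
      ∀ U ∈ Set.Ioo U₁ U₂, ∃ L₀ : ℕ, ∀ (L : ℕ) [NeZero L], L₀ ≤ L → Even L →
        let N : ℕ := 2 * ⌊(1 - δ) * (L : ℝ) ^ 2 / 2⌋₊
        let H := hubbardTorus 2 L 1 U
        let S := szSector (Λ := FermionTorus 2 L) N 0
        let PS := projMatrix (S.map (Fock.toEuclidean (ι := Orb (FermionTorus 2 L)) :
          Fock (Orb (FermionTorus 2 L)) →ₗ[ℂ] EuclideanSpace ℂ (Finset (Orb (FermionTorus 2 L)))))
        ∀ᶠ β : ℝ in atTop, c * (L : ℝ) ^ 4 ≤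
          ((PS * gibbsWeight β H *
              ((pairField dWaveFormFactor L)ᴴ * pairField dWaveFormFactor L)).trace /
            (PS * gibbsWeight β H).trace).re) :
    BirGroundStateAverageLRO := by
  unfold BirGroundStateAverageLRO
  obtain ⟨δ, hδ, U₁, U₂, c, hU₁, hU₁₂, hc, h⟩ := h
  refine ⟨δ, hδ, U₁, U₂, c, hU₁, hU₁₂, hc, fun U hU => ?_⟩
  obtain ⟨L₀, hL₀⟩ := h U hU
  refine ⟨L₀, fun L _ hL hLe => ?_⟩
  intro N H S E₀ P
  have hδ' : (-1 : ℝ) ≤ δ := by linarith [hδ.1]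
  exact birTraceBound_of_eventually_thermal L 1 U δ c hδ' (hL₀ L hL hLe)

/-- **The reduction in thermal form implies the item.** If the engine `BirComplexStableXY` yields
the THERMAL sector bound (canonical `(N_L, S^z = 0)` Gibbs average of `Δ_d† Δ_d` at least `c L⁴`
for all large `β`, on an open window of couplings, eventually in even `L`), then
`BirGappedPhaseReduction` (engine → `BirGroundStateAverageLRO`) holds: the `β → ∞` passage from
the canonical equilibrium state to the uniform ground-eigenspace average is
`birGroundStateAverageLRO_of_thermal`. Tasaki (2020) App. A. [folklore] -/
theorem birGappedPhaseReduction_of_thermal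
    (h : BirComplexStableXY →
      ∃ δ ∈ Set.Ioo (0:ℝ) (1/2), ∃ U₁ U₂ c : ℝ, 0 < U₁ ∧ U₁ < U₂ ∧ 0 < c ∧
      ∀ U ∈ Set.Ioo U₁ U₂, ∃ L₀ : ℕ, ∀ (L : ℕ) [NeZero L], L₀ ≤ L → Even L →
        let N : ℕ := 2 * ⌊(1 - δ) * (L : ℝ) ^ 2 / 2⌋₊
        let H := hubbardTorus 2 L 1 U
        let S := szSector (Λ := FermionTorus 2 L) N 0
        let PS := projMatrix (S.map (Fock.toEuclidean (ι := Orb (FermionTorus 2 L)) :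
          Fock (Orb (FermionTorus 2 L)) →ₗ[ℂ] EuclideanSpace ℂ (Finset (Orb (FermionTorus 2 L)))))
        ∀ᶠ β : ℝ in atTop, c * (L : ℝ) ^ 4 ≤
          ((PS * gibbsWeight β H *
              ((pairField dWaveFormFactor L)ᴴ * pairField dWaveFormFactor L)).trace /
            (PS * gibbsWeight β H).trace).re) :
    BirGappedPhaseReduction :=
  fun hE => birGroundStateAverageLRO_of_thermal (h hE)

end Hubbard

end Summit.HubbardSuperconductivity.HubbardSuperconductivity.Theorems
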